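import Summits.QuantumFields.BalabanUV.Beta.EriceRemainderEnclosureHistoryAutonomyComparisonDefectOscillation

/-!
# EriceRemainderEnclosureHistoryAutonomyComparisonDefectUniform — (E140g) **THE DEFICIT SATURATES AT THE MEMORY LENGTH: `1∕h′_j² ≥ 1∕h_j² − (K−1)·θδ∕(1−θ)`, UNIFORMLY IN
# THE DEPTH.**  (E140c) bounds the level deficit of an orbit of `B′` (sign-free excess over a structured memory `B` with `K` ages, defect `τ`, oscillation `δ`,
# `(1+τ)θ ≤ 1`, `θ < 1`) by `j·F`, `F = θδ∕(1−θ)`, at depth `j` — a bound growing with the depth, because it adds up the negative parts of the dual steps and forgets the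
# positive ones.  But a dual step can only be negative by BORROWING from positive steps in its own window ((E138b)'s lower link: `X⁻_n ≤ Σ_k Λ_k Σ_{1≤l≤k} X⁺_{n+l}`, total
# weight `θ ≤ 1`), and the level difference `L_j = 1∕h′_j² − 1∕h_j²` obeys the LINDLEY recursion `L_{j+1} ≥ X_j + min(L_j, 0)` (a base orbit restarted at `h′_j` stays on the
# right side of `h`'s, (E138a) `base_level_gap_between`).  Hence `L_j` is bounded below by the worst INTERVAL sum of the dual steps, and in any interval the negative steps are
# repaid by the positive steps of the same interval except for those of the last `K−1` rows, each `≥ −F` ((E140c) `dual_steps_osc`).  RESULT (`level_deficit_le_uniform`):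
#   **`1∕h_j² − (K−1)·θδ∕(1−θ) ≤ 1∕h′_j²`  for EVERY `j`**  — with (E140c): deficit `≤ min(j, K−1)·θδ∕(1−θ)`; `δ = 0` is comparison itself ((E140a)); one age (`K = 2`):
# deficit `≤ θδ∕(1−θ)` against (E49b)'s exact `θδ∕(1+θ)`.  In coupling terms `h′_j ≤ h_j∕√(1 − c·h_j²)`, `c = (K−1)θδ∕(1−θ)`: the correction DIES OUT in the ultraviolet.

Cell `pub-balaban`, β-function sub-cell, BINDER row D4 «RemainderConst leaves for Bałaban's split» (`HOME/BINDER-OWNERS.md`; owner lineage `b2b-balaban-beta-an4`;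
this file by co-owner #2 lineage `b2b-balaban-beta-d4-p2`, generation 108), β-FLOW TEAM duty (1), FREEZE (0) honoured (def-free; (E140c) `dual_steps_osc`, (E138b)
`flow_link_lower`, (E138a) `dual_step_eq_levels` ∕ `base_level_gap_between`, (E48a) `family_succ_eq` ∕ `family_zero`, (E39) `exists_memFlow_zm`, (E43b)
`memFlow_unique_of_monotone_zm` BY NAME; nothing restated).  Diagnosis behind it: `HOME/b2b-balaban-beta-d4-p2/g108/kit/deficitgrowth.py` (square-wave remainders switching
at every scale: the deficit stays `≤ 0.012` at depth `120` while (E140c)'s bound reaches `24`–`288`).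

HONEST FRAMING (page 1, verbatim and binding).  *"Discharging BetaPertH makes Bałaban's UV stability UNCONDITIONAL — a real constructive-QFT result; it is
NOT the continuum limit and NOT the Clay problem."*  THIS FILE DISCHARGES NOTHING OF THE KIND.  Elementary real analysis about ABSTRACT functionals on a box
]0,γ]^ℕ (node U2's `MemFlow` ∕ `SeqBox`) — hypotheses of a census, not facts: nothing about Bałaban's (1.22) limit functional is PRINTED in this form ([I] p. 298;
GAPS G-t4-U2-1∕-2) or asserted.  Row D4 class UNCHANGED (critical-path width 0; instance 0∕1; D4 DISCHARGE NO DATE).  NOT B12 Thm 2, NOT BetaPertH, NOT continuum YM,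
NOT Clay.

WHAT IS PROVED ([folklore]; 0 `def`, 0 sorry).  §1 (sequences) **`lindley_lower`**, `shifted_sum_le`, **`interval_sum_lower`**.  §2 (flow)
`neg_part_le_window`, `level_rec_lower`.  §3 **`level_deficit_le_uniform`**, `coupling_le_uniform`.
-/

noncomputable section
open Finset Set

namespace Summit.QuantumFields.BalabanUV.Beta.EriceRemainderEnclosureHistoryAutonomyComparisonDefectUniform

open Literature.MathematicalPhysics.QuantumFieldTheory.Balaban1983to89
open Literature.MathematicalPhysics.QuantumFieldTheory.Balaban1983to89.T4BetaStationary
open Literature.MathematicalPhysics.QuantumFieldTheory.Balaban1983to89.T4BetaFlowWellPosed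
open Summit.QuantumFields.BalabanUV.Beta.EriceRemainderEnclosureHistoryAutonomyOrder (family_zero family_succ_eq)
open Summit.QuantumFields.BalabanUV.Beta.EriceRemainderEnclosureHistoryAutonomyComparisonDualContractionLinks (dual_step_eq_levels base_level_gap_between)
open Summit.QuantumFields.BalabanUV.Beta.EriceRemainderEnclosureHistoryAutonomyComparisonDualContraction (flow_link_lower)
open Summit.QuantumFields.BalabanUV.Beta.EriceRemainderEnclosureHistoryAutonomyComparisonDefectOscillation (dual_steps_osc)

/-! ## §1 Two sequence lemmas: the Lindley recursion, and interval sums of steps that borrow forward -/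

/-- **THE LINDLEY RECURSION.**  If `L_0 ≥ 0` and `L_{j+1} ≥ X_j + min(L_j, 0)` for all `j`, then `L_j` is bounded below by the worst interval sum of `X` ending at `j`: in
particular `−C ≤ L_j` as soon as every interval sum `Σ_{a<t} X_{i+a}` is `≥ −C`. [folklore] -/
theorem lindley_lower {L X : ℕ → ℝ} {C : ℝ} (hL0 : 0 ≤ L 0) (hrec : ∀ j, X j + min (L j) 0 ≤ L (j + 1))
    (hint : ∀ i t : ℕ, -C ≤ ∑ a ∈ range t, X (i + a)) (j : ℕ) : -C ≤ L j := by
  suffices h : ∃ i, i ≤ j ∧ ∑ a ∈ range (j - i), X (i + a) ≤ L j by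
    obtain ⟨i, _, hs⟩ := h
    exact (hint i (j - i)).trans hs
  induction j with
  | zero => exact ⟨0, le_rfl, by simpa using hL0⟩
  | succ j ih =>
    by_cases hLj : 0 ≤ L j
    · refine ⟨j, j.le_succ, ?_⟩
      rw [show j + 1 - j = 1 by omega, sum_range_one, Nat.add_zero]
      have := hrec j
      rw [min_eq_right hLj] at this
      linarith
    · obtain ⟨i, hi, hs⟩ := ih
      refine ⟨i, hi.trans j.le_succ, ?_⟩
      have e : j + 1 - i = (j - i) + 1 := by omega
      rw [e, sum_range_succ, show i + (j - i) = j by omega]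
      have := hrec j
      rw [min_eq_left (le_of_lt (lt_of_not_ge hLj))] at this
      linarith

/-- A shifted partial sum of non-negative terms inside a longer one: `Σ_{a<t′} g(s + a) ≤ Σ_{c<t} g c` when `s + t′ ≤ t` and `g ≥ 0`. [folklore] -/
theorem shifted_sum_le {g : ℕ → ℝ} (hg : ∀ c, 0 ≤ g c) {s t' t : ℕ} (hst : s + t' ≤ t) :
    ∑ a ∈ range t', g (s + a) ≤ ∑ c ∈ range t, g c := by
  obtain ⟨d, rfl⟩ : ∃ d, t = s + d := ⟨t - s, by omega⟩
  have hd : t' ≤ d := by omega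
  rw [sum_range_add]
  have hsub : range t' ⊆ range d := fun x hx => mem_range.mpr (lt_of_lt_of_le (mem_range.mp hx) hd)
  have h1 : ∑ a ∈ range t', g (s + a) ≤ ∑ a ∈ range d, g (s + a) :=
    sum_le_sum_of_subset_of_nonneg hsub fun a _ _ => hg _
  have h2 : 0 ≤ ∑ c ∈ range s, g c := sum_nonneg fun c _ => hg c
  linarith

/-- **INTERVAL SUMS OF FORWARD-BORROWING STEPS.**  A real sequence `X` with (i) `X_n ≥ −F` for all `n` (`F ≥ 0`) and (ii) the BORROWING inequality
`X⁻_n ≤ Σ_{k<K} Λ_k Σ_{l<k} X⁺_{n+l+1}` (`Λ ≥ 0`, `Σ_k k·Λ_k ≤ 1`: a negative step is covered by the positive steps of the next `K−1` rows, with total weight at most one).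
Then EVERY interval sum satisfies **`Σ_{a<t} X_{i+a} ≥ −(K−1)·F`**: inside the interval the negative steps of all but the last `K−1` rows are repaid by the interval's own
positive steps; the last `K−1` rows cost at most `F` each. [folklore] -/
theorem interval_sum_lower {X Λ : ℕ → ℝ} {K : ℕ} {F : ℝ}
    (hΛ : ∀ k, 0 ≤ Λ k) (hθ1 : ∑ k ∈ range K, (k : ℝ) * Λ k ≤ 1) (hF : 0 ≤ F)
    (hlow : ∀ n, -F ≤ X n)
    (hborrow : ∀ n, max (-X n) 0 ≤ ∑ k ∈ range K, Λ k * ∑ l ∈ range k, max (X (n + (l + 1))) 0)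
    (i t : ℕ) : -(((K - 1 : ℕ) : ℝ) * F) ≤ ∑ a ∈ range t, X (i + a) := by
  -- positive and negative parts along the interval
  set Sp : ℝ := ∑ a ∈ range t, max (X (i + a)) 0 with hSp
  set Sm : ℝ := ∑ a ∈ range t, max (-X (i + a)) 0 with hSm
  have hsplit : ∑ a ∈ range t, X (i + a) = Sp - Sm := by
    rw [hSp, hSm, ← sum_sub_distrib]
    exact sum_congr rfl fun a _ => (max_zero_sub_max_neg_zero_eq_self _).symm
  have hSp0 : 0 ≤ Sp := sum_nonneg fun a _ => le_max_right _ _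
  have hnegF : ∀ n, max (-X n) 0 ≤ F := fun n => max_le (by linarith [hlow n]) hF
  rw [hsplit]
  -- it suffices: Sm ≤ Sp + (K-1)·F
  suffices hkey : Sm ≤ Sp + ((K - 1 : ℕ) : ℝ) * F by linarith
  set r : ℕ := K - 1 with hr
  by_cases ht : t ≤ r
  · -- short interval: every row is a boundary row
    have h1 : Sm ≤ ∑ a ∈ range t, F := sum_le_sum fun a _ => hnegF _
    rw [sum_const, card_range, nsmul_eq_mul] at h1
    have h2 : (t : ℝ) * F ≤ (r : ℝ) * F := mul_le_mul_of_nonneg_right (by exact_mod_cast ht) hF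
    linarith
  · -- long interval: t = t' + r with t' ≥ 1 interior rows
    have htr : r < t := lt_of_not_ge ht
    set t' : ℕ := t - r with ht'
    have e : t = t' + r := by omega
    have hSm_split : Sm = ∑ a ∈ range t', max (-X (i + a)) 0 + ∑ c ∈ range r, max (-X (i + (t' + c))) 0 := by
      rw [hSm, e, sum_range_add]
    -- boundary rows
    have hbd : ∑ c ∈ range r, max (-X (i + (t' + c))) 0 ≤ (r : ℝ) * F := by
      have h1 : ∑ c ∈ range r, max (-X (i + (t' + c))) 0 ≤ ∑ c ∈ range r, F := sum_le_sum fun c _ => hnegF _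
      rwa [sum_const, card_range, nsmul_eq_mul] at h1
    -- interior rows: borrow from the interval's own positive steps
    have hint : ∑ a ∈ range t', max (-X (i + a)) 0 ≤ Sp := by
      have h1 : ∑ a ∈ range t', max (-X (i + a)) 0
          ≤ ∑ a ∈ range t', ∑ k ∈ range K, Λ k * ∑ l ∈ range k, max (X (i + a + (l + 1))) 0 :=
        sum_le_sum fun a _ => hborrow (i + a)
      -- exchange the sums
      have h2 : ∑ a ∈ range t', ∑ k ∈ range K, Λ k * ∑ l ∈ range k, max (X (i + a + (l + 1))) 0
          = ∑ k ∈ range K, Λ k * ∑ l ∈ range k, ∑ a ∈ range t', max (X (i + a + (l + 1))) 0 := by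
        rw [sum_comm]
        refine sum_congr rfl fun k _ => ?_
        rw [← mul_sum, sum_comm]
      -- each shifted inner sum is inside Sp
      have h3 : ∀ k ∈ range K, ∀ l ∈ range k, ∑ a ∈ range t', max (X (i + a + (l + 1))) 0 ≤ Sp := by
        intro k hk l hl
        have hkK := mem_range.mp hk
        have hlk := mem_range.mp hl
        have hs : (i + (l + 1)) + t' ≤ i + t := by omega
        have := shifted_sum_le (g := fun c => max (X c) 0) (fun c => le_max_right _ _) (s := i + (l + 1)) (t' := t') (t := i + t) hs
        -- rewrite both sides to the displayed forms
        have eL : ∑ a ∈ range t', max (X (i + a + (l + 1))) 0 = ∑ a ∈ range t', max (X (i + (l + 1) + a)) 0 :=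
          sum_congr rfl fun a _ => by rw [show i + a + (l + 1) = i + (l + 1) + a by omega]
        have eR : ∑ c ∈ range (i + t), max (X c) 0 = ∑ c ∈ range i, max (X c) 0 + Sp := by
          rw [hSp, sum_range_add]
        rw [eL]
        have h0 : 0 ≤ ∑ c ∈ range i, max (X c) 0 := sum_nonneg fun c _ => le_max_right _ _
        -- Σ_{c<i} + Sp ≥ shifted sum, but we need the bound by Sp alone: shift the comparison interval to start at i
        have := shifted_sum_le (g := fun c => max (X (i + c)) 0) (fun c => le_max_right _ _) (s := l + 1) (t' := t') (t := t) (by omega)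
        have eL' : ∑ a ∈ range t', max (X (i + (l + 1) + a)) 0 = ∑ a ∈ range t', max (X (i + (l + 1 + a))) 0 :=
          sum_congr rfl fun a _ => by rw [show i + (l + 1) + a = i + (l + 1 + a) by omega]
        rw [eL']
        exact this
      have h4 : ∑ k ∈ range K, Λ k * ∑ l ∈ range k, ∑ a ∈ range t', max (X (i + a + (l + 1))) 0
          ≤ ∑ k ∈ range K, Λ k * ∑ l ∈ range k, Sp :=
        sum_le_sum fun k hk => mul_le_mul_of_nonneg_left (sum_le_sum fun l hl => h3 k hk l hl) (hΛ k)
      have h5 : ∑ k ∈ range K, Λ k * ∑ l ∈ range k, Sp = (∑ k ∈ range K, (k : ℝ) * Λ k) * Sp := by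
        rw [sum_mul]
        refine sum_congr rfl fun k _ => ?_
        rw [sum_const, card_range, nsmul_eq_mul]; ring
      have h6 : (∑ k ∈ range K, (k : ℝ) * Λ k) * Sp ≤ 1 * Sp := mul_le_mul_of_nonneg_right hθ1 hSp0
      linarith [h1, h2.le, h2.ge, h4, h5.le, h6]
    rw [hSm_split]
    linarith

/-! ## §2 The flow: the borrowing inequality and the Lindley recursion of the level difference -/

variable {B B' : (ℕ → ℝ) → ℝ} {M γ b : ℝ} {S : ℝ → ℕ → ℝ} {h h' : ℕ → ℝ}

/-- **A NEGATIVE DUAL STEP BORROWS FROM THE POSITIVE STEPS OF ITS WINDOW**: `X⁻_n ≤ Σ_{k<K} Λ_k Σ_{l<k} X⁺_{n+l+1}` — (E138b)'s lower link `E_n − X_n ≤ Σ_k Λ_k Σ_{l≤k} X⁺_{n+l}`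
with `E_n ≥ 0` and, when `X_n < 0`, the `l = 0` terms absent. [folklore] -/
theorem neg_part_le_window {Λ : ℕ → ℝ} {K : ℕ} (hb : 0 < b)
    (hmono : ∀ u v : ℕ → ℝ, SeqBox γ u → SeqBox γ v → (∀ i, u i ≤ v i) → B u ≤ B v)
    (hB : ∀ u u' : ℕ → ℝ, SeqBox γ u → SeqBox γ u' → ∀ D : ℝ, (∀ j, |u j - u' j| ≤ D) → |B u - B u'| ≤ M * D) (hM : 0 ≤ M)
    (hlo : ∀ u, SeqBox γ u → b ≤ B u)
    (hS : ∀ p, 0 < p → p ≤ γ → SeqBox γ (S p) ∧ MemFlow B p (S p))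
    (huniq : ∀ p, 0 < p → p ≤ γ → ∀ u u' : ℕ → ℝ, SeqBox γ u → SeqBox γ u' → MemFlow B p u → MemFlow B p u' → u = u')
    (hΛ : ∀ k, 0 ≤ Λ k)
    (hLip : ∀ u v : ℕ → ℝ, SeqBox γ u → SeqBox γ v → (∀ k : ℕ, 1 / γ ^ 2 + ((k : ℝ) + 1) * b ≤ 1 / u k ^ 2) →
      (∀ k : ℕ, 1 / γ ^ 2 + ((k : ℝ) + 1) * b ≤ 1 / v k ^ 2) → B u - B v ≤ ∑ k ∈ range K, Λ k * max (1 / v k ^ 2 - 1 / u k ^ 2) 0)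
    (hexc : ∀ u, SeqBox γ u → B u ≤ B' u)
    (hh' : SeqBox γ h') {y : ℝ} (hy : 0 < y) (hyγ : y ≤ γ) (hf' : MemFlow B' y h') (n : ℕ) :
    max (-(1 / h' (n + 1) ^ 2 - 1 / S (h' n) 1 ^ 2)) 0
      ≤ ∑ k ∈ range K, Λ k * ∑ l ∈ range k, max (1 / h' (n + (l + 1) + 1) ^ 2 - 1 / S (h' (n + (l + 1))) 1 ^ 2) 0 := by
  have hlink := flow_link_lower hb hmono hB hM hlo hS huniq hΛ hLip hexc hh' hy hyγ hf' n
  have hE0 : 0 ≤ B' (fun i => h' (n + 1 + i)) - B (fun i => h' (n + 1 + i)) := sub_nonneg.mpr (hexc _ fun i => hh' (n + 1 + i))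
  have hrhs0 : 0 ≤ ∑ k ∈ range K, Λ k * ∑ l ∈ range k, max (1 / h' (n + (l + 1) + 1) ^ 2 - 1 / S (h' (n + (l + 1))) 1 ^ 2) 0 :=
    sum_nonneg fun k _ => mul_nonneg (hΛ k) (sum_nonneg fun l _ => le_max_right _ _)
  by_cases hX : 0 ≤ 1 / h' (n + 1) ^ 2 - 1 / S (h' n) 1 ^ 2
  · rw [max_eq_right (by linarith)]; exact hrhs0
  · have hX' : 1 / h' (n + 1) ^ 2 - 1 / S (h' n) 1 ^ 2 < 0 := lt_of_not_ge hX
    rw [max_eq_left (by linarith)]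
    -- split off the l = 0 terms, which vanish
    have hz : max (1 / h' (n + 0 + 1) ^ 2 - 1 / S (h' (n + 0)) 1 ^ 2) 0 = 0 := by
      simp only [Nat.add_zero]; exact max_eq_right hX'.le
    have hsplit : ∀ k ∈ range K, Λ k * ∑ l ∈ range (k + 1), max (1 / h' (n + l + 1) ^ 2 - 1 / S (h' (n + l)) 1 ^ 2) 0
        = Λ k * ∑ l ∈ range k, max (1 / h' (n + (l + 1) + 1) ^ 2 - 1 / S (h' (n + (l + 1))) 1 ^ 2) 0 := by
      intro k _
      rw [sum_range_succ', hz, add_zero]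
    rw [sum_congr rfl hsplit] at hlink
    linarith

/-- **THE LINDLEY RECURSION OF THE LEVEL DIFFERENCE**: with `L_j = 1∕h′_j² − 1∕(S y)_j²` and the dual step `X_j = 1∕h′_{j+1}² − 1∕(S h′_j)_1²`,
`L_{j+1} ≥ X_j + min(L_j, 0)` — `L_{j+1} − X_j` is the scale-1 level gap between the base orbits from the pins `h′_j` and `(S y)_j`, which keeps the sign of `L_j` and does
not grow ((E138a) `base_level_gap_between`, (E48a) `family_succ_eq`). [folklore] -/
theorem level_rec_lower (hb : 0 < b)
    (hmono : ∀ u v : ℕ → ℝ, SeqBox γ u → SeqBox γ v → (∀ i, u i ≤ v i) → B u ≤ B v)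
    (hB : ∀ u u' : ℕ → ℝ, SeqBox γ u → SeqBox γ u' → ∀ D : ℝ, (∀ j, |u j - u' j| ≤ D) → |B u - B u'| ≤ M * D) (hM : 0 ≤ M)
    (hlo : ∀ u, SeqBox γ u → b ≤ B u)
    (hS : ∀ p, 0 < p → p ≤ γ → SeqBox γ (S p) ∧ MemFlow B p (S p))
    (huniq : ∀ p, 0 < p → p ≤ γ → ∀ u u' : ℕ → ℝ, SeqBox γ u → SeqBox γ u' → MemFlow B p u → MemFlow B p u' → u = u')
    (hh' : SeqBox γ h') {y : ℝ} (hy : 0 < y) (hyγ : y ≤ γ) (j : ℕ) :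
    (1 / h' (j + 1) ^ 2 - 1 / S (h' j) 1 ^ 2) + min (1 / h' j ^ 2 - 1 / S y j ^ 2) 0
      ≤ 1 / h' (j + 1) ^ 2 - 1 / S y (j + 1) ^ 2 := by
  have hq := (hS y hy hyγ).1 j
  have hgap := (base_level_gap_between hb hmono hB hM hlo hS huniq (hh' j).1 (hh' j).2 hq.1 hq.2 1).2
  rw [← family_succ_eq hS huniq hy hyγ j] at hgap
  have e : min (1 / h' j ^ 2 - 1 / S y j ^ 2) 0 = -max (-(1 / h' j ^ 2 - 1 / S y j ^ 2)) 0 := by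
    rcases le_total (1 / h' j ^ 2 - 1 / S y j ^ 2) 0 with hx | hx
    · rw [min_eq_left hx, max_eq_left (by linarith)]; ring
    · rw [min_eq_right hx, max_eq_right (by linarith)]; ring
  rw [e]
  linarith

/-! ## §3 The uniform deficit bound -/

/-- **THE DEFICIT SATURATES AT THE MEMORY LENGTH.**  `B`: isotone on the box `]0,γ]^ℕ`, zeroth moment `M`, floor `b > 0`, LEVEL-LIPSCHITZ IN ITS HISTORY with age profile
`Λ ≥ 0` on `range K` over the graded box, `θ := Σ_{k<K} k·Λ_k < 1`.  `B′`: ANY functional with `B ≤ B′ ≤ β̄` on the box whose excess `D = B′ − B` satisfies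
`u ≤ v ⟹ D u ≤ (1+τ)·D v + δ` (`τ, δ ≥ 0`), `(1+τ)θ ≤ 1`.  `h, h′`: ANY box solutions of `B, B′` from one pin `p`.  Then at EVERY scale `j`
**`1∕h_j² − (K−1)·θδ∕(1−θ) ≤ 1∕h′_j²`** — uniformly in the depth (with (E140c): the deficit is `≤ min(j, K−1)·θδ∕(1−θ)`).  Proof: Lindley recursion of the level
difference (`level_rec_lower`), interval sums of the dual steps (`interval_sum_lower` fed by (E140c) `dual_steps_osc` and `neg_part_le_window`). [folklore] -/
theorem level_deficit_le_uniform {Λ : ℕ → ℝ} {K : ℕ} {βb p τ δ : ℝ}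
    (hmono : ∀ u v : ℕ → ℝ, SeqBox γ u → SeqBox γ v → (∀ i, u i ≤ v i) → B u ≤ B v)
    (hB : ∀ u u' : ℕ → ℝ, SeqBox γ u → SeqBox γ u' → ∀ D : ℝ, (∀ j, |u j - u' j| ≤ D) → |B u - B u'| ≤ M * D) (hM : 0 ≤ M)
    (hb : 0 < b) (hlo : ∀ u, SeqBox γ u → b ≤ B u)
    (hΛ : ∀ k, 0 ≤ Λ k) (hθ : ∑ k ∈ range K, (k : ℝ) * Λ k < 1)
    (hτ : 0 ≤ τ) (hθτ : (1 + τ) * ∑ k ∈ range K, (k : ℝ) * Λ k ≤ 1) (hδ : 0 ≤ δ)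
    (hLip : ∀ u v : ℕ → ℝ, SeqBox γ u → SeqBox γ v → (∀ k : ℕ, 1 / γ ^ 2 + ((k : ℝ) + 1) * b ≤ 1 / u k ^ 2) →
      (∀ k : ℕ, 1 / γ ^ 2 + ((k : ℝ) + 1) * b ≤ 1 / v k ^ 2) → B u - B v ≤ ∑ k ∈ range K, Λ k * max (1 / v k ^ 2 - 1 / u k ^ 2) 0)
    (hexc : ∀ u, SeqBox γ u → B u ≤ B' u) (hbdd : ∀ u, SeqBox γ u → B' u ≤ βb)
    (hDosc : ∀ u v : ℕ → ℝ, SeqBox γ u → SeqBox γ v → (∀ i, u i ≤ v i) → B' u - B u ≤ (1 + τ) * (B' v - B v) + δ)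
    (hp : 0 < p) (hpγ : p ≤ γ) (hh : SeqBox γ h) (hf : MemFlow B p h) (hh' : SeqBox γ h') (hf' : MemFlow B' p h') (j : ℕ) :
    1 / h j ^ 2 - ((K - 1 : ℕ) : ℝ) * ((∑ k ∈ range K, (k : ℝ) * Λ k) * δ / (1 - ∑ k ∈ range K, (k : ℝ) * Λ k)) ≤ 1 / h' j ^ 2 := by
  set F : ℝ := (∑ k ∈ range K, (k : ℝ) * Λ k) * δ / (1 - ∑ k ∈ range K, (k : ℝ) * Λ k) with hFdef
  -- the unique base family
  have hex : ∀ q : ℝ, 0 < q → q ≤ γ → ∃ k : ℕ → ℝ, SeqBox γ k ∧ MemFlow B q k :=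
    fun q hq hqγ => Summit.QuantumFields.BalabanUV.Beta.EriceRemainderEnclosureHistoryAutonomyExistence.exists_memFlow_zm hB hM hq hqγ hb hlo
  choose! S hSb hSf using hex
  have hS : ∀ q, 0 < q → q ≤ γ → SeqBox γ (S q) ∧ MemFlow B q (S q) := fun q hq hqγ => ⟨hSb q hq hqγ, hSf q hq hqγ⟩
  have huniq : ∀ q, 0 < q → q ≤ γ → ∀ u u' : ℕ → ℝ, SeqBox γ u → SeqBox γ u' → MemFlow B q u → MemFlow B q u' → u = u' :=
    fun q hq _ u u' hu hu' hfu hfu' =>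
      Summit.QuantumFields.BalabanUV.Beta.EriceRemainderEnclosureHistoryAutonomyMonotoneGeneral.memFlow_unique_of_monotone_zm
        hmono hB hM hq hb hlo hu hu' hfu hfu'
  have e : h = S p := huniq p hp hpγ _ _ hh (hS p hp hpγ).1 hf (hS p hp hpγ).2
  have hθ0 : 0 ≤ ∑ k ∈ range K, (k : ℝ) * Λ k := sum_nonneg fun k _ => mul_nonneg (Nat.cast_nonneg k) (hΛ k)
  have hF0 : 0 ≤ F := div_nonneg (mul_nonneg hθ0 hδ) (by linarith)
  -- the Lindley bound for L_j = 1/h′_j² − 1/(S p)_j² with the dual steps X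
  have key := lindley_lower (L := fun j => 1 / h' j ^ 2 - 1 / S p j ^ 2) (X := fun m => 1 / h' (m + 1) ^ 2 - 1 / S (h' m) 1 ^ 2)
    (C := ((K - 1 : ℕ) : ℝ) * F)
    (by show 0 ≤ 1 / h' 0 ^ 2 - 1 / S p 0 ^ 2; rw [hf'.1, family_zero hS hp hpγ]; simp)
    (fun j => level_rec_lower hb hmono hB hM hlo hS huniq hh' hp hpγ j)
    (fun i t => interval_sum_lower (X := fun m => 1 / h' (m + 1) ^ 2 - 1 / S (h' m) 1 ^ 2) hΛ hθ.le hF0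
      (fun n => (dual_steps_osc hb hmono hB hM hlo hS huniq hΛ hθ hτ hθτ hδ hLip hexc hbdd hDosc hh' hp hpγ hf' n).1)
      (fun n => neg_part_le_window hb hmono hB hM hlo hS huniq hΛ hLip hexc hh' hp hpγ hf' n) i t) j
  have key' : -(((K - 1 : ℕ) : ℝ) * F) ≤ 1 / h' j ^ 2 - 1 / S p j ^ 2 := key
  rw [e]
  linarith

/-- **COUPLING FORM: `h′_j ≤ h_j ∕ √(1 − c·h_j²)`, `c = (K−1)θδ∕(1−θ)`** (when `c·h_j² < 1`) — the correction factor tends to `1` along the orbit (`h_j → 0`): sign-free remainders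
with an oscillation are enclosed ASYMPTOTICALLY EXACTLY in the ultraviolet. [folklore] -/
theorem coupling_le_uniform {Λ : ℕ → ℝ} {K : ℕ} {βb p τ δ : ℝ}
    (hmono : ∀ u v : ℕ → ℝ, SeqBox γ u → SeqBox γ v → (∀ i, u i ≤ v i) → B u ≤ B v)
    (hB : ∀ u u' : ℕ → ℝ, SeqBox γ u → SeqBox γ u' → ∀ D : ℝ, (∀ j, |u j - u' j| ≤ D) → |B u - B u'| ≤ M * D) (hM : 0 ≤ M)
    (hb : 0 < b) (hlo : ∀ u, SeqBox γ u → b ≤ B u)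
    (hΛ : ∀ k, 0 ≤ Λ k) (hθ : ∑ k ∈ range K, (k : ℝ) * Λ k < 1)
    (hτ : 0 ≤ τ) (hθτ : (1 + τ) * ∑ k ∈ range K, (k : ℝ) * Λ k ≤ 1) (hδ : 0 ≤ δ)
    (hLip : ∀ u v : ℕ → ℝ, SeqBox γ u → SeqBox γ v → (∀ k : ℕ, 1 / γ ^ 2 + ((k : ℝ) + 1) * b ≤ 1 / u k ^ 2) →
      (∀ k : ℕ, 1 / γ ^ 2 + ((k : ℝ) + 1) * b ≤ 1 / v k ^ 2) → B u - B v ≤ ∑ k ∈ range K, Λ k * max (1 / v k ^ 2 - 1 / u k ^ 2) 0)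
    (hexc : ∀ u, SeqBox γ u → B u ≤ B' u) (hbdd : ∀ u, SeqBox γ u → B' u ≤ βb)
    (hDosc : ∀ u v : ℕ → ℝ, SeqBox γ u → SeqBox γ v → (∀ i, u i ≤ v i) → B' u - B u ≤ (1 + τ) * (B' v - B v) + δ)
    (hp : 0 < p) (hpγ : p ≤ γ) (hh : SeqBox γ h) (hf : MemFlow B p h) (hh' : SeqBox γ h') (hf' : MemFlow B' p h') (j : ℕ)
    (hc : ((K - 1 : ℕ) : ℝ) * ((∑ k ∈ range K, (k : ℝ) * Λ k) * δ / (1 - ∑ k ∈ range K, (k : ℝ) * Λ k)) * h j ^ 2 < 1) :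
    h' j ≤ h j / Real.sqrt (1 - ((K - 1 : ℕ) : ℝ) * ((∑ k ∈ range K, (k : ℝ) * Λ k) * δ / (1 - ∑ k ∈ range K, (k : ℝ) * Λ k)) * h j ^ 2) := by
  have hdef := level_deficit_le_uniform hmono hB hM hb hlo hΛ hθ hτ hθτ hδ hLip hexc hbdd hDosc hp hpγ hh hf hh' hf' j
  set c : ℝ := ((K - 1 : ℕ) : ℝ) * ((∑ k ∈ range K, (k : ℝ) * Λ k) * δ / (1 - ∑ k ∈ range K, (k : ℝ) * Λ k)) with hcdef
  have hpj : 0 < h j := (hh j).1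
  have hpj' : 0 < h' j := (hh' j).1
  have h1 : 0 < 1 - c * h j ^ 2 := by linarith
  -- (1 − c h_j²)/h_j² ≤ 1/h′_j², i.e. (1 − c h_j²)·h′_j² ≤ h_j²
  have hlev : (1 - c * h j ^ 2) / h j ^ 2 ≤ 1 / h' j ^ 2 := by
    have e1 : (1 - c * h j ^ 2) / h j ^ 2 = 1 / h j ^ 2 - c := by field_simp
    rw [e1]; exact hdef
  have hsq : (1 - c * h j ^ 2) * h' j ^ 2 ≤ h j ^ 2 := by
    rw [div_le_div_iff₀ (pow_pos hpj 2) (pow_pos hpj' 2), one_mul] at hlev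
    linarith
  have hs1 : Real.sqrt (1 - c * h j ^ 2) * h' j ≤ h j := by
    have e1 : Real.sqrt ((1 - c * h j ^ 2) * h' j ^ 2) = Real.sqrt (1 - c * h j ^ 2) * h' j := by
      rw [Real.sqrt_mul h1.le, Real.sqrt_sq hpj'.le]
    have e2 : Real.sqrt (h j ^ 2) = h j := Real.sqrt_sq hpj.le
    have := Real.sqrt_le_sqrt hsq
    rwa [e1, e2] at this
  rw [le_div_iff₀ (Real.sqrt_pos.mpr h1), mul_comm]
  exact hs1

end Summit.QuantumFields.BalabanUV.Beta.EriceRemainderEnclosureHistoryAutonomyComparisonDefectUniform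

end
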